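import Mathlib.RingTheory.DedekindDomain.Dvr
import Mathlib.RingTheory.Localization.Away.Basic
import Mathlib.RingTheory.Valuation.ValuationRing
import HarnessLib

/-!
# Non-zero ideals of a Dedekind domain are principal on a basic open neighbourhood of any prime

Topic: `Literature/RingTheory/DedekindDomain`. Let `A` be a Dedekind domain, `J ⊆ A` a non-zero
ideal and `𝔭` a prime ideal. Then there are `g ∉ 𝔭` and `0 ≠ y ∈ J` with `J A[1/g] = y A[1/g]`:
non-zero ideals of a Dedekind domain are invertible, hence Zariski-locally principal (Stacks,
Tag 0AUW / the local rings `A_𝔭` are discrete valuation rings, in which finitely many elements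
generate the ideal generated by one of them; clear denominators). Consequently the closed
subscheme `V(J) ⊆ Spec A` is an effective Cartier divisor.

* `exists_notMem_and_map_eq_span` — **the statement above** (for any localisation `A[1/g]`).

## References

* The Stacks Project, Tag 0AUW (Dedekind domains: local rings are DVRs), Tag 07ZD.
  [StacksProject]
-/

namespace Literature.RingTheory.DedekindDomain

open IsLocalization

/-- In a valuation ring, the ideal generated by a non-empty finite set is generated by one of its
members. [folklore] -/
theorem exists_mem_span_eq_span_singleton {R : Type*} [CommRing R] [IsDomain R] [ValuationRing R]
    (s : Finset R) (hs : s.Nonempty) :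
    ∃ t ∈ s, Ideal.span (↑s : Set R) = Ideal.span {t} := by
  classical
  induction s using Finset.induction_on with
  | empty => exact absurd hs (Finset.not_nonempty_empty)
  | insert a s ha ih =>
    by_cases hs' : s.Nonempty
    · obtain ⟨t, hts, hst⟩ := ih hs'
      rw [Finset.coe_insert, Ideal.span_insert, hst]
      rcases total_of (· ≤ ·) (Ideal.span {a} : Ideal R) (Ideal.span {t}) with h | h
      · exact ⟨t, Finset.mem_insert_of_mem hts, sup_eq_right.mpr h⟩
      · exact ⟨a, Finset.mem_insert_self a s, sup_eq_left.mpr h⟩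
    · rw [Finset.not_nonempty_iff_eq_empty] at hs'
      subst hs'
      exact ⟨a, Finset.mem_insert_self a _, by simp⟩

/-- **Non-zero ideals of a Dedekind domain are principal on a basic open neighbourhood of any
prime.** For `A` a Dedekind domain, `J ≠ 0` an ideal and `𝔭` a prime, there are `g ∉ 𝔭` and
`0 ≠ y ∈ J` such that `J A[1/g] = (y)` in every localisation `A[1/g]`.
[cite: StacksProject, Tag 0AUW] -/
theorem exists_notMem_and_map_eq_span {A : Type*} [CommRing A] [IsDedekindDomain A]
    {J : Ideal A} (hJ : J ≠ ⊥) (p : Ideal A) [hp : p.IsPrime] :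
    ∃ g : A, g ∉ p ∧ ∃ y ∈ J, y ≠ 0 ∧
      ∀ (Ag : Type*) [CommRing Ag] [Algebra A Ag] [IsLocalization.Away g Ag],
        J.map (algebraMap A Ag) = Ideal.span {algebraMap A Ag y} := by
  classical
  by_cases hp0 : p = ⊥
  · -- at the generic point: invert a non-zero element of `J`
    subst hp0
    obtain ⟨y, hyJ, hy0⟩ := J.ne_bot_iff.mp hJ
    refine ⟨y, by simpa using hy0, y, hyJ, hy0, fun Ag _ _ _ => ?_⟩
    have hu : IsUnit (algebraMap A Ag y) := IsLocalization.Away.algebraMap_isUnit y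
    rw [Ideal.span_singleton_eq_top.mpr hu]
    exact Ideal.eq_top_of_isUnit_mem _ (Ideal.mem_map_of_mem _ hyJ) hu
  -- generators of `J`
  obtain ⟨s, hs⟩ := (IsNoetherian.noetherian J : J.FG)
  have hsne : s.Nonempty := by
    rw [Finset.nonempty_iff_ne_empty]
    rintro rfl
    exact hJ (by rw [← hs]; simp)
  -- in the discrete valuation ring `A_𝔭` one of them generates
  let Ap := Localization.AtPrime p
  haveI : IsDiscreteValuationRing Ap :=
    IsLocalization.AtPrime.isDiscreteValuationRing_of_dedekind_domain A hp0 Ap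
  have hinj : Function.Injective (algebraMap A Ap) :=
    IsLocalization.injective Ap p.primeCompl_le_nonZeroDivisors
  obtain ⟨y, hys, hy⟩ := exists_mem_span_eq_span_singleton (s.image (algebraMap A Ap))
    (hsne.image _)
  obtain ⟨y, hys', rfl⟩ := Finset.mem_image.mp hys
  have hyJ : y ∈ J := hs ▸ Ideal.subset_span hys'
  have hmapP : J.map (algebraMap A Ap) = Ideal.span {algebraMap A Ap y} := by
    rw [← hs, Ideal.map_span, ← hy, Finset.coe_image]
  have hy0 : y ≠ 0 := by
    rintro rfl
    apply hJ
    rw [map_zero, Ideal.span_singleton_eq_bot.mpr rfl] at hmapP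
    exact (Ideal.map_eq_bot_iff_of_injective hinj).mp hmapP
  -- clear denominators: `aⱼ y = j uⱼ` with `uⱼ ∉ 𝔭`, for every generator `j`
  have hden : ∀ j ∈ s, ∃ u : A, u ∈ p.primeCompl ∧ ∃ a : A, a * y = j * u := by
    intro j hj
    have hjm : algebraMap A Ap j ∈ J.map (algebraMap A Ap) :=
      Ideal.mem_map_of_mem _ (hs ▸ Ideal.subset_span hj)
    rw [hmapP, Ideal.mem_span_singleton'] at hjm
    obtain ⟨c, hc⟩ := hjm
    obtain ⟨⟨a, u⟩, rfl⟩ := IsLocalization.mk'_surjective p.primeCompl c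
    refine ⟨u, u.2, a, hinj ?_⟩
    rw [map_mul, map_mul, ← hc, mul_comm (IsLocalization.mk' Ap a u), mul_assoc,
      IsLocalization.mk'_spec, mul_comm]
  choose! u hu a hua using hden
  refine ⟨∏ j ∈ s, u j, ?_, y, hyJ, hy0, fun Ag _ _ _ => ?_⟩
  · exact prod_mem (fun j hj => hu j hj)
  · apply le_antisymm
    · rw [← hs, Ideal.map_span, Ideal.span_le]
      rintro _ ⟨j, hj, rfl⟩
      -- `uⱼ` divides `g`, so it is a unit in `A[1/g]`
      have hunit : IsUnit (algebraMap A Ag (u j)) := by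
        have hg : IsUnit (algebraMap A Ag (∏ j ∈ s, u j)) := IsLocalization.Away.algebraMap_isUnit _
        rw [← Finset.mul_prod_erase s u hj, map_mul] at hg
        exact isUnit_of_mul_isUnit_left hg
      rw [SetLike.mem_coe, Ideal.mem_span_singleton']
      refine ⟨algebraMap A Ag (a j) * ↑hunit.unit⁻¹, ?_⟩
      have key : algebraMap A Ag (a j) * algebraMap A Ag y = algebraMap A Ag j * algebraMap A Ag (u j) := by
        rw [← map_mul, ← map_mul, hua j hj]
      calc algebraMap A Ag (a j) * ↑hunit.unit⁻¹ * algebraMap A Ag y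
          = algebraMap A Ag (a j) * algebraMap A Ag y * ↑hunit.unit⁻¹ := by ring
        _ = algebraMap A Ag j * (algebraMap A Ag (u j) * ↑hunit.unit⁻¹) := by rw [key, mul_assoc]
        _ = algebraMap A Ag j := by rw [IsUnit.mul_val_inv, mul_one]
    · rw [Ideal.span_le, Set.singleton_subset_iff]
      exact Ideal.mem_map_of_mem _ hyJ

end Literature.RingTheory.DedekindDomain
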